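import Literature.AnabelianGeometry.AbsoluteAnabelian.AbsAnabProp121viiCupCyclicClass
import Literature.AnabelianGeometry.AbsoluteAnabelian.LocalUnramifiedQuotientH2
import Literature.NumberTheory.GaloisRepresentations.InfResTwo
import HarnessLib

/-!
# [AbsAnab] Prop 1.2.1 (vii), sub-DAG row L05′ (core): the Brauer route of the canonical class

Proof-only file (abc-iut cell, layer L4; sub-DAG `plan/L4/SUBDAG-AbsAnab-Prop121vii.md`, row
L05′ `InvariantMapIsBrauerComposite`, core part; statements holder abc-iut-w5-d198).  S. Mochizuki,
*The Absolute Anabelian Geometry of Hyperbolic Curves* (2004) [AbsAnab], proof of Prop 1.2.1 (vii),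
p. 11 l. 59 – p. 12 l. 2: the residue map of `K` is the composite of (N1) the Kummer isomorphism
`H²(G_K, μ_{ℚ/ℤ}(K̄)) ⥲ H²(G_K, K̄^×)`, (N2) the inverse of the inflation
`H²(Gal(K^unr/K), (K^unr)^×) ⥲ H²(G_K, K̄^×)` and (N3)
`H²(Gal(K^unr/K), (K^unr)^×) ⥲ H²(Gal(K^unr/K), ℤ) = H²(Ẑ, ℤ) = ℚ/ℤ` (valuation, then evaluation of
the Bockstein-inverse at the Frobenius).  The sub-DAG types the residue map at level `n` by the
characterisation `Prop121vii.IsInvariantMap` (`inv(κ_n(π) ∪ χ) = 1`); this file computes print's chain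
on that canonical class, independently of the valuation map and of the acyclicity of the units of
`K^unr` (rows P32.i.L03/L04 of the [AbsTopIII] Prop 3.2 sub-DAG, bricks V/U of abc-iut-w5-d214):

* `Prop121vii.inf_cyclicClass` — inflation `H²(G/N, A^N) → H²(G, A)` carries the cyclic class
  `κ_{χ̄}(a) = [c_{χ̄} ⊗ a]` of the tree (`cyclicClass`, `CyclicLayerCarry.lean`: Serre's `a ∪ δχ`)
  to `κ_χ(a)` for `χ = χ̄ ∘ (G → G/N)`;
* `Prop121vii.cohomologyMap_cyclicClass` — `κ_χ` is natural in the coefficient module;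
* `Prop121vii.exists_cyclicClass_trivial_eq_δ₁` — for the TRIVIAL module `ℤ`, `κ_χ(1) ∈ H²(Γ, ℤ)` is
  the continuous Bockstein `δ₁[χ/d]` of `0 → ℤ → ℚ → ℚ/ℤ → 0` applied to the character
  `q ↦ (χ q)/d ∈ ℚ/ℤ`: the carry cocycle IS the connecting cocycle of the lift `q ↦ (χ̃ q)/d ∈ ℚ`;
* `Prop121vii.brauerRoute_canonicalClass` — **ASSEMBLY** at `Q = G_K ⧸ I_K` (`I_K = galUnr K`):
  for the Frobenius-normalised unramified cyclic character `ψ : G_K ↠ ℤ/n` (`ψ(I_K) = 0`,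
  `ψ(φ) = 1` for an arithmetic Frobenius `φ`), a `G_K`-invariant `u ∈ K̄^×` (a uniformiser) and the
  crossed homomorphism `g = ψ·id : G_K → μ_n^∨(1)`: the image of the canonical class
  `κ_n(u) ∪ [g]` under `H²(G_K, μ_n) → H²(G_K, K̄^×) = Br(K)` (N1) is `−inf((s_u)_* w)` where
  `s_u : ℤ → (K̄^×)^{I_K}`, `k ↦ u^k` (a `Q`-equivariant section of the valuation) and
  `w ∈ H²(Gal(K^unr/K), ℤ)` is a class with `H2UnrEquivQModZ hφ w = 1/n` (abc-iut-L4-t16's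
  «`H²(Ẑ, ℤ) = ℚ/ℤ`, evaluation at the Frobenius»).  Hence print's composite N3 ∘ N2⁻¹ ∘ N1 takes
  the value `−1/n` on the canonical class once the valuation `v` (with `v ∘ s_u = id`, `v(u) = 1`)
  is applied — the global sign is the cup-product ordering convention `μ_n × μ_n^∨(1)` of the sub-DAG
  (recorded 2026-08-26 by abc-iut-w5-d198/abc-iut-L6-d2: `inv_{IsInvariantMap} = −inv_K^{Serre}`),
  shared by `K₁` and `K₂` and therefore immaterial to Prop 1.2.1 (vii).

Inputs by name: `cohomologyMap_kummerι_cupProduct_δ₀_scalar` (abc-iut-w5-d201: Kummer image of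
`κ_n(u) ∪ [g]` is `−κ_ψ(u)`), `H2UnrEquivQModZ_symm_apply_eq` (abc-iut-L4-t16), `isSES_ZQ`,
`IsSES.δ₁_oneCocycleClass`, `map_twoCocycleClass`.  Only theorems; the descended character, the
section `s_u` and the class `w` are produced by existence statements.
HONEST FRAMING: classical local class field theory (Serre, *Local Fields* XIII §3, XIV §1 Prop. 2–3);
kernel-checking an undisputed step.  Nothing here bears on [IUTchIII] Cor. 3.12.

## References
* [MochizukiAbsAnab2004] S. Mochizuki, *The absolute anabelian geometry of hyperbolic curves* (2004),
  Prop 1.2.1 (vii), proof p. 11–12.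
* [SerreLocalFields1979] J.-P. Serre, *Local Fields*, GTM 67 (1979), XIII §3, XIV §1 Prop. 2–3.
-/

noncomputable section

universe u

namespace Literature.AnabelianGeometry.AbsoluteAnabelian

namespace Prop121vii

open Field CategoryTheory ValuativeRel ContRepresentation
open Literature.NumberTheory.GaloisRepresentations
open Literature.NumberTheory.GaloisRepresentations.DiscreteGaloisModule

/-! ### §1. Inflation and functoriality of the cyclic class `κ_χ(a) = [c_χ ⊗ a]` -/

section CyclicClassFunctorial

variable {G : Type u} [Group G] [TopologicalSpace G] [IsTopologicalGroup G] [LocallyCompactSpace G]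
variable {d : ℕ} [NeZero d]
variable {A : Type u} [AddCommGroup A] [TopologicalSpace A] [DiscreteTopology A]
variable {A' : Type u} [AddCommGroup A'] [TopologicalSpace A'] [DiscreteTopology A']

omit [IsTopologicalGroup G] [LocallyCompactSpace G] [NeZero d] in
/-- The carry cocycle of a character pulled back from a quotient is the pull-back of the carry
cocycle. [cite: SerreLocalFields1979, XIII §3] -/
theorem carryFun_eq_of_comp {H : Type u} [Group H] [TopologicalSpace H] (θ : G →* H)
    (χ : CyclicCharacter G d) (χ' : CyclicCharacter H d) (hχ : ∀ σ, χ σ = χ' (θ σ)) (σ τ : G) :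
    χ.carryFun σ τ = χ'.carryFun (θ σ) (θ τ) := by
  change ((((χ σ).val + (χ τ).val) / d : ℕ) : ℤ) = ((((χ' (θ σ)).val + (χ' (θ τ)).val) / d : ℕ) : ℤ)
  rw [hχ, hχ]

/-- **Inflation of cyclic classes**: for a normal subgroup `N ⊴ G`, a cyclic character `χ̄` of `G/N`
with pull-back `χ` to `G`, and a `G`-invariant `b ∈ A` (an invariant `a` of the `G/N`-module `A^N` with
the same underlying element), `inf κ_{χ̄}(a) = κ_χ(b)` in `H²(G, A)` — the inflation of the carry cocycle
is the carry cocycle. [cite: SerreLocalFields1979, XIII §3] -/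
theorem inf_cyclicClass (N : Subgroup G) [N.Normal] [LocallyCompactSpace (G ⧸ N)]
    (χbar : CyclicCharacter (G ⧸ N) d) (χ : CyclicCharacter G d)
    (hχ : ∀ σ, χ σ = χbar (QuotientGroup.mk σ)) (ρ : ContinuousRep G ℤ A)
    (a : ((ρ.quotientInvariants N).toTopRep).ρ.invariants) (b : ρ.toTopRep.ρ.invariants)
    (hab : ((a : ρ.invariantsOf N) : A) = (b : A)) :
    ContinuousCohomology.map (ContinuousMonoidHom.quotientMk N) (invariantsInclusion N ρ) 2
        (cyclicClass χbar (ρ.quotientInvariants N) a) = cyclicClass χ ρ b := by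
  rw [cyclicClass_apply, cyclicClass_apply, map_twoCocycleClass]
  refine congrArg _ (Subtype.ext (ContinuousMap.ext fun p => ?_))
  obtain ⟨σ, τ⟩ := p
  rw [contTwoCocycles.pullback_apply, carryCocycle_apply, carryCocycle_apply, map_zsmul,
    invariantsInclusion_hom_apply, carryFun_eq_of_comp (QuotientGroup.mk' N) χ χbar hχ σ τ]
  change χbar.carryFun (QuotientGroup.mk σ) (QuotientGroup.mk τ) • ((a : ρ.invariantsOf N) : A) = _
  rw [hab]
  rfl

/-- **Naturality of cyclic classes in the module**: for a morphism `f : A → A'` of discrete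
`G`-modules and invariants `a`, `a'` with `f a = a'`, `H²(f) κ_χ(a) = κ_χ(a')`.
[cite: SerreLocalFields1979, XIV §1 Prop. 2] -/
theorem cohomologyMap_cyclicClass (χ : CyclicCharacter G d) {ρ : ContinuousRep G ℤ A}
    {ρ' : ContinuousRep G ℤ A'} (f : ρ.toTopRep ⟶ ρ'.toTopRep) (a : ρ.toTopRep.ρ.invariants)
    (a' : ρ'.toTopRep.ρ.invariants) (h : f.hom (a : A) = (a' : A')) :
    cohomologyMap f 2 (cyclicClass χ ρ a) = cyclicClass χ ρ' a' := by
  rw [cyclicClass_apply, cyclicClass_apply, cohomologyMap_twoCocycleClass]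
  refine congrArg _ (Subtype.ext (ContinuousMap.ext fun p => ?_))
  obtain ⟨σ, τ⟩ := p
  rw [pullback₂_id_resIdHom_apply, carryCocycle_apply, carryCocycle_apply, map_zsmul]
  change χ.carryFun σ τ • f.hom (a : A) = _
  rw [h]

end CyclicClassFunctorial

/-! ### §2. The carry class of the trivial module `ℤ` is the Bockstein of the character -/

section Bockstein

variable {Γ : Type u} [Group Γ] [TopologicalSpace Γ] [IsTopologicalGroup Γ] [LocallyCompactSpace Γ]
variable {d : ℕ} [NeZero d]

/-- **`κ_χ(1) = δ[χ/d]` in `H²(Γ, ℤ)`**: for a cyclic character `χ : Γ ↠ ℤ/d` and the TRIVIAL module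
`ℤ`, the cyclic class of `1` — the class of the carry cocycle
`c_χ(σ, τ) = (χ̃σ + χ̃τ − χ̃(στ))/d` — is the image under the continuous Bockstein
`δ₁ : H¹(Γ, ℚ/ℤ) → H²(Γ, ℤ)` of `0 → ℤ → ℚ → ℚ/ℤ → 0` of the continuous character
`q ↦ χ̃(q)/d mod ℤ`, `χ̃(q) ∈ [0, d)` the lift (Serre: `δχ ∈ H²(G, ℤ)`).
[cite: SerreLocalFields1979, XIV §1 Prop. 2] -/
theorem exists_cyclicClass_trivial_eq_δ₁ (χ : CyclicCharacter Γ d) :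
    ∃ φ : contOneCocycles (ContinuousRep.trivial Γ ℤ QModZCoeff.{u}).toTopRep,
      (∀ q : Γ, φ.1 q = QCoeff.toQModZ (QCoeff.mk (((χ q).val : ℚ) / d))) ∧
        cyclicClass χ (ContinuousRep.trivial Γ ℤ ZCoeff.{u}) ⟨ULift.up 1, fun _ => rfl⟩ =
          (isSES_ZQ Γ).δ₁ (oneCocycleClass _ φ) := by
  have hd : (d : ℚ) ≠ 0 := Nat.cast_ne_zero.2 (NeZero.ne d)
  -- the rational lift `q ↦ χ̃(q)/d`
  let φt : C(Γ, QCoeff.{u}) :=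
    ⟨fun q => QCoeff.mk (((χ q).val : ℚ) / d),
      (continuous_of_discreteTopology (f := fun a : ZMod d => QCoeff.mk.{u} ((a.val : ℚ) / d))).comp
        χ.continuous⟩
  have hφt_val : ∀ q, QCoeff.val (φt q) = ((χ q).val : ℚ) / d := fun q => rfl
  -- `χ̃(στ)/d ≡ χ̃σ/d + χ̃τ/d (mod ℤ)`: the difference is the carry
  have hcarryQ : ∀ σ τ : Γ, (χ.carryFun σ τ : ℚ) =
      ((χ σ).val : ℚ) / d + ((χ τ).val : ℚ) / d - ((χ (σ * τ)).val : ℚ) / d := by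
    intro σ τ
    have h := χ.natCast_mul_carryFun σ τ
    have h' : (d : ℚ) * (χ.carryFun σ τ : ℚ) =
        ((χ σ).val : ℚ) + ((χ τ).val : ℚ) - ((χ (σ * τ)).val : ℚ) := by
      exact_mod_cast h
    field_simp
    linarith
  have hφ : ∀ σ τ : Γ, (trivialHom Γ QCoeff.toQModZ.{u}).hom (φt (σ * τ)) =
      (trivialHom Γ QCoeff.toQModZ.{u}).hom (φt σ) +
        ContinuousRep.trivial Γ ℤ QModZCoeff.{u} σ ((trivialHom Γ QCoeff.toQModZ.{u}).hom (φt τ)) := by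
    intro σ τ
    rw [ContinuousRep.trivial_apply, trivialHom_hom_apply, trivialHom_hom_apply, trivialHom_hom_apply,
      ← map_add, eq_comm, ← sub_eq_zero, ← map_sub, QCoeff.toQModZ_eq_zero_iff]
    refine ⟨⟨χ.carryFun σ τ⟩, QCoeff.val_injective ?_⟩
    rw [ZCoeff.val_toQ, sub_eq_add_neg, ← neg_one_zsmul, QCoeff.val_add, QCoeff.val_add,
      QCoeff.val_zsmul, hφt_val, hφt_val, hφt_val]
    change (χ.carryFun σ τ : ℚ) = _
    rw [hcarryQ]
    ring
  refine ⟨IsSES.pushCocycle φt hφ, fun q => rfl, ?_⟩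
  rw [(isSES_ZQ Γ).δ₁_oneCocycleClass φt hφ, cyclicClass_apply]
  refine congrArg _ (Subtype.ext (ContinuousMap.ext fun p => ?_))
  obtain ⟨σ, τ⟩ := p
  apply (isSES_ZQ Γ).injective
  rw [(isSES_ZQ Γ).f_connectingCocycle_apply, carryCocycle_apply, ContinuousRep.trivial_apply,
    trivialHom_hom_apply]
  apply QCoeff.val_injective
  rw [ZCoeff.val_toQ, sub_eq_add_neg, ← neg_one_zsmul, QCoeff.val_add, QCoeff.val_add,
    QCoeff.val_zsmul, hφt_val, hφt_val, hφt_val]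
  change (((χ.carryFun σ τ • (1 : ℤ) : ℤ)) : ℚ) = _
  rw [smul_eq_mul, mul_one, hcarryQ]
  ring

end Bockstein

/-! ### §3. Assembly over `Q = G_K ⧸ I_K`: print's chain on the canonical class -/

section Unramified

variable (K : Type u) [Field K] [ValuativeRel K] [TopologicalSpace K] [IsNonarchimedeanLocalField K]
  [CharZero K]

omit [CharZero K] in
/-- **Descent of an unramified cyclic character** to `Q = G_K ⧸ I_K` (`I_K = galUnr K`): a cyclic
character `ψ : G_K ↠ ℤ/d` killing `galUnr K` is the pull-back of a (unique) cyclic character of the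
quotient. [cite: SerreLocalFields1979, XIII §3] -/
theorem exists_cyclicCharacter_quotient_galUnr {d : ℕ} (ψ : CyclicCharacter (absoluteGaloisGroup K) d)
    (hI : ∀ σ ∈ galUnr K, ψ σ = 0) :
    ∃ ψbar : CyclicCharacter (absoluteGaloisGroup K ⧸ galUnr K) d,
      ∀ σ, ψ σ = ψbar (QuotientGroup.mk σ) := by
  -- `ψ` as a monoid homomorphism to `Multiplicative (ℤ/d)`, and its descent
  let ψm : absoluteGaloisGroup K →* Multiplicative (ZMod d) :=
    { toFun := fun σ => Multiplicative.ofAdd (ψ σ)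
      map_one' := by rw [ψ.map_one]; rfl
      map_mul' := fun σ τ => by rw [ψ.map_mul]; rfl }
  have hker : ∀ x ∈ galUnr K, ψm x = 1 := fun x hx => by
    change Multiplicative.ofAdd (ψ x) = 1
    rw [hI x hx]; rfl
  let ψl : absoluteGaloisGroup K ⧸ galUnr K →* Multiplicative (ZMod d) := QuotientGroup.lift _ ψm hker
  have hψl : ∀ σ, ψl (QuotientGroup.mk σ) = Multiplicative.ofAdd (ψ σ) := fun σ => rfl
  have hcont : Continuous fun q => Multiplicative.toAdd (ψl q) := by
    rw [(QuotientGroup.isQuotientMap_mk (galUnr K)).continuous_iff]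
    exact ψ.continuous.congr fun σ => rfl
  refine ⟨⟨fun q => Multiplicative.toAdd (ψl q), fun q q' => by rw [map_mul]; rfl, hcont, fun a => ?_⟩,
    fun σ => rfl⟩
  obtain ⟨σ, hσ⟩ := ψ.surjective a
  exact ⟨QuotientGroup.mk σ, hσ⟩

omit [CharZero K] in
/-- **The section `k ↦ u^k` of the valuation**: a `G_K`-invariant `u ∈ K̄^×` (e.g. a uniformiser of `K`)
defines a `Q`-equivariant map `ℤ → (K̄^×)^{I_K}` from the trivial module; recorded with the
`Q`-invariant `a = u` it hits at `1`. [cite: SerreLocalFields1979, XIII §3] -/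
theorem exists_section_of_invariant (u : (units K).toTopRep.ρ.invariants) :
    ∃ (a : ((ContinuousRep.quotientInvariants (galUnr K) (units K)).toTopRep).ρ.invariants)
      (s : (ContinuousRep.trivial (absoluteGaloisGroup K ⧸ galUnr K) ℤ ZCoeff.{u}).toTopRep ⟶
        (ContinuousRep.quotientInvariants (galUnr K) (units K)).toTopRep),
      ((a : ContinuousRep.invariantsOf (galUnr K) (units K)) : UnitsCarrier K) = (u : UnitsCarrier K) ∧
        ∀ k : ZCoeff.{u}, s.hom k = k.down • (a : ContinuousRep.invariantsOf (galUnr K) (units K)) := by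
  -- `u` is `I_K`-invariant, and `Q`-invariant in `(K̄^×)^{I_K}`
  let ub : ContinuousRep.invariantsOf (galUnr K) (units K) := ⟨(u : UnitsCarrier K), fun σ => u.2 (σ : absoluteGaloisGroup K)⟩
  have hub : ∀ q : absoluteGaloisGroup K ⧸ galUnr K, ContinuousRep.quotientInvariants (galUnr K) (units K) q ub = ub := by
    intro q
    induction q using QuotientGroup.induction_on with
    | H σ => exact Subtype.ext (u.2 σ)
  let a : ((ContinuousRep.quotientInvariants (galUnr K) (units K)).toTopRep).ρ.invariants := ⟨ub, hub⟩
  -- the map `k ↦ k • u`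
  let L : ZCoeff.{u} →+ ContinuousRep.invariantsOf (galUnr K) (units K) :=
    { toFun := fun k => k.down • ub
      map_zero' := zero_zsmul _
      map_add' := fun k k' => add_zsmul _ _ _ }
  refine ⟨a, TopRep.ofHom ⟨⟨L.toIntLinearMap, continuous_of_discreteTopology⟩, fun q => ?_⟩, rfl,
    fun k => rfl⟩
  refine ContinuousLinearMap.ext fun k => ?_
  change L (ContinuousRep.trivial _ ℤ ZCoeff.{u} q k) = ContinuousRep.quotientInvariants (galUnr K) (units K) q (L k)
  rw [ContinuousRep.trivial_apply]
  change k.down • ub = ContinuousRep.quotientInvariants (galUnr K) (units K) q (k.down • ub)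
  rw [map_zsmul, hub]

/-- The class of `H²(Gal(K^nr/K), ℤ)` attached to the Frobenius-normalised unramified character has
print-invariant `1/n`: `H2UnrEquivQModZ (δ₁[ψ̄/n]) = 1/n` when `ψ(φ) = 1` («`H²(Ẑ, ℤ) = ℚ/ℤ`»,
evaluation at the Frobenius). [cite: MochizukiAbsAnab2004, Prop 1.2.1 (vii) p.11] -/
theorem H2UnrEquivQModZ_δ₁_normalized {n : ℕ} [NeZero n] {φF : absoluteGaloisGroup K}
    (hφF : IsFrobPow φF 1) (ψbar : CyclicCharacter (absoluteGaloisGroup K ⧸ galUnr K) n)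
    (hψ1 : ψbar (QuotientGroup.mk φF) = 1)
    (φ : contOneCocycles
      (ContinuousRep.trivial (absoluteGaloisGroup K ⧸ galUnr K) ℤ QModZCoeff.{u}).toTopRep)
    (hφ : ∀ q, φ.1 q = QCoeff.toQModZ (QCoeff.mk (((ψbar q).val : ℚ) / n))) :
    H2UnrEquivQModZ hφF ((isSES_ZQ (absoluteGaloisGroup K ⧸ galUnr K)).δ₁ (oneCocycleClass _ φ)) =
      QCoeff.toQModZ (QCoeff.mk ((1 : ℚ) / n)) := by
  have hx : φ.1 (QuotientGroup.mk φF) = QCoeff.toQModZ (QCoeff.mk ((1 : ℚ) / n)) := by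
    rw [hφ, hψ1]
    rcases Nat.lt_or_ge 1 n with h1 | h1
    · haveI : Fact (1 < n) := ⟨h1⟩
      rw [ZMod.val_one]
      rfl
    · have hn : n = 1 := le_antisymm h1 (NeZero.pos n)
      subst hn
      have h0 : QCoeff.mk.{u} 0 = 0 := QCoeff.val_injective (by rw [QCoeff.val_mk, QCoeff.val_zero])
      rw [ZMod.val_one_eq_one_mod, Nat.mod_self, Nat.cast_zero, zero_div, Nat.cast_one, div_one, h0,
        map_zero, eq_comm, QCoeff.toQModZ_eq_zero_iff]
      exact ⟨⟨1⟩, QCoeff.val_injective (by rw [ZCoeff.val_toQ, QCoeff.val_mk, Int.cast_one])⟩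
  rw [← H2UnrEquivQModZ_symm_apply_eq hφF _ φ hx, LinearEquiv.apply_symm_apply]

/-- **[AbsAnab] Prop 1.2.1 (vii), row L05′ (core): the Brauer route of the canonical class.**  Let `K`
be an MLF (valued form, characteristic `0`), `I_K = galUnr K`, `Q = G_K ⧸ I_K = Gal(K^nr/K)`, `φ` an
arithmetic Frobenius, `ψ : G_K ↠ ℤ/n` a cyclic character with `ψ(I_K) = 0`, `ψ(φ) = 1` (the
normalised unramified character), `g = ψ·id : G_K → μ_n^∨(1)` and `u ∈ K̄^×` a `G_K`-invariant (a
uniformiser of `K`).  Then there are a `Q`-equivariant `s : ℤ → (K̄^×)^{I_K}`, `k ↦ u^k` (a section of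
the valuation when `u` is a uniformiser) and a class `w ∈ H²(Gal(K^nr/K), ℤ)` of print-invariant
`H2UnrEquivQModZ w = 1/n` («`H²(Ẑ, ℤ) = ℚ/ℤ`», evaluation at `φ`) such that the image of the canonical
class `κ_n(u) ∪ [g]` under the Kummer map `H²(G_K, μ_n) → H²(G_K, K̄^×) = Br(K)` (N1) is
`−Inf(s_* w)` (N2⁻¹, N3 read backwards) — print's chain `N3 ∘ N2⁻¹ ∘ N1` sends the canonical class
to `−1/n`, the sign being the sub-DAG's cup-product ordering `μ_n × μ_n^∨(1)`.
[cite: MochizukiAbsAnab2004, Prop 1.2.1 (vii) p.11] -/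
theorem brauerRoute_canonicalClass {n : ℕ} [NeZero n] [Finite (MuCarrier K n)]
    {φF : absoluteGaloisGroup K} (hφF : IsFrobPow φF 1)
    (ψ : CyclicCharacter (absoluteGaloisGroup K) n) (hI : ∀ σ ∈ absInertia K, ψ σ = 0) (hψ1 : ψ φF = 1)
    (g : contOneCocycles ((mu K n).tateDual n).toTopRep)
    (hg : ∀ (σ : absoluteGaloisGroup K) (m : MuCarrier K n),
      g.1 σ m = (((ψ σ).val : ℤ)) • MuCarrier.toAdditive m)
    (u : (units K).toTopRep.ρ.invariants) :
    ∃ (s : (ContinuousRep.trivial (absoluteGaloisGroup K ⧸ galUnr K) ℤ ZCoeff.{u}).toTopRep ⟶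
          (ContinuousRep.quotientInvariants (galUnr K) (units K)).toTopRep)
      (w : continuousCohomology 2
        (ContinuousRep.trivial (absoluteGaloisGroup K ⧸ galUnr K) ℤ ZCoeff.{u}).toTopRep),
      (∀ k : ZCoeff.{u}, ((s.hom k : ContinuousRep.invariantsOf (galUnr K) (units K)) : UnitsCarrier K) =
          k.down • (u : UnitsCarrier K)) ∧
        H2UnrEquivQModZ hφF w = QCoeff.toQModZ (QCoeff.mk ((1 : ℚ) / n)) ∧
        cohomologyMap (kummerι K n) 2
            (((mu K n).tateDualPairing n).cupProduct ((isSES_kummer K n (NeZero.pos n)).δ₀ u)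
              (oneCocycleClass _ g)) =
          - ContinuousCohomology.map (ContinuousMonoidHom.quotientMk (galUnr K))
              (invariantsInclusion (galUnr K) (units K)) 2 (cohomologyMap s 2 w) := by
  -- N1: the Kummer image of the canonical class is `−κ_ψ(u)` (abc-iut-w5-d201)
  have hN1 := cohomologyMap_kummerι_cupProduct_δ₀_scalar ψ g hg u
  -- descend `ψ` to `Q`, build the section and the Bockstein class
  have hI' : ∀ σ ∈ galUnr K, ψ σ = 0 := fun σ hσ => hI σ (galUnr_le_absInertia K hσ)
  obtain ⟨ψbar, hψbar⟩ := exists_cyclicCharacter_quotient_galUnr K ψ hI'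
  obtain ⟨a, s, hau, hs⟩ := exists_section_of_invariant K u
  obtain ⟨φ, hφ, hclass⟩ := exists_cyclicClass_trivial_eq_δ₁
    (Γ := absoluteGaloisGroup K ⧸ galUnr K) ψbar
  refine ⟨s, (isSES_ZQ (absoluteGaloisGroup K ⧸ galUnr K)).δ₁ (oneCocycleClass _ φ), fun k => ?_,
    H2UnrEquivQModZ_δ₁_normalized K hφF ψbar (by rw [← hψbar, hψ1]) φ hφ, ?_⟩
  · rw [hs, Submodule.coe_smul, hau]
  · have h1 : s.hom ((⟨ULift.up 1, fun _ => rfl⟩ :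
        ((ContinuousRep.trivial (absoluteGaloisGroup K ⧸ galUnr K) ℤ ZCoeff.{u}).toTopRep).ρ.invariants) :
          ZCoeff.{u}) = ((a : ContinuousRep.invariantsOf (galUnr K) (units K))) := by
      rw [hs]
      exact one_zsmul _
    rw [hN1, ← hclass, cohomologyMap_cyclicClass ψbar s _ a h1,
      inf_cyclicClass (galUnr K) ψbar ψ hψbar (units K) a u hau]

end Unramified

end Prop121vii

end Literature.AnabelianGeometry.AbsoluteAnabelian

end
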